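import Summits.Parity.GeneralizedHardyLittlewood.Theorems.ParityWeightedChenSwitchingParityChenInequalityTools
import Summits.Parity.GeneralizedHardyLittlewood.Theorems.ParityWeightedChenSwitchingParityChenInequalityPrimeSum
import Summits.Parity.GeneralizedHardyLittlewood.Theorems.ChenParityOracleBLAPParityOracleChenUpperSum
import HarnessLib

/-!
# Route `ParityWeightedChenSwitching` — crux `ParityChenInequality` (stmt-Parity-18666): estimate (B)ᵘ

The UPPER linear-sieve estimate, summed over the primes `x^{1/8} ≤ q < y(x)`, for the sequences
`𝒜(x)_q` of Chen's twin sequence weighted by the parity weight `u(n) = (1 − μ(n))/2`, at the FIXED level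
`D = x^{0.499}` (each `𝒜_q` sifted to level `D/q`): for every `ε > 0` and all large `x`,
`Φ₂(x) := ∑_q ∑_{n ∈ 𝒜(x), q ∣ n, x^{1/8}-rough} (1 − μ(n))/2 ≤ (e^γ Λ/8 + ε)(x/log x)V(x^{1/8}) + ½ E₁(x)`,
`Λ = (log((1/3)/(0.499 − 1/3)) − log((1/8)/(0.499 − 1/8)))/0.499 = ∫_{1/8}^{1/3} dt/(t(0.499 − t))`,
`E₁(x) = ∑_{m ≤ x^{0.499}} |∑_{p ≤ x, m ∣ p+2} μ(p + 2)|` (the registered stub `stub_upperSum`, unfolded).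
This is the tree's PROVED estimate (B) `Chen.twin_sieveUpperSum_holds` (Nathanson Thm 10.5 for `{p + 2}`)
through the twisted Rosser sieve `Iwaniec1980_twisted_upper_of_half_lt` (`b = ½ 1_{𝒜_q}(1 − μ)`,
`e = 1_{𝒜_q} μ`) — the sibling route's `parity_twin_sieveUpperSum` with level `x^{0.499}`
(`s_q = 8(0.499 − log q/log x)`, prime sum `sum_primesIco_weight_le_level0499`) and the oracle remainders
rearranged (`(q, d) ↦ qd` injective) into `≤ E₁(x)`, kept POINTWISE.

References: [Nathanson1996] Thm 10.5; [ChenSciSinica1973] p. 176; [IwaniecActaArith1980] Thm 1;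
[Harman2007] §14.2.
-/

namespace Summit.Parity.GeneralizedHardyLittlewood.Theorems

open Finset Filter Topology
open scoped ArithmeticFunction.Moebius ArithmeticFunction.Omega
open Literature.NumberTheory.Sieve Literature.NumberTheory.Sieve.Chen
  Literature.NumberTheory.Sieve.ChenSieve Literature.NumberTheory.Sieve.SieveSequence

set_option maxHeartbeats 1600000 in
/-- **(B)ᵘ — the upper bound for the parity-weighted `𝒜_q`, summed over `q`, at level `0.499`.**
For every `ε > 0` and all large `x`,
`∑_{x^{1/8} ≤ q < y(x), q prime} ∑_{n ∈ 𝒜(x), q ∣ n, x^{1/8}-rough} (1 − μ(n))/2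
  ≤ (e^γ Λ/8 + ε)(x/log x)V(x^{1/8}) + ½ ∑_{m ≤ x^{0.499}} |∑_{p ≤ x, m ∣ p+2} μ(p+2)|`,
`Λ = (log((1/3)/(0.499−1/3)) − log((1/8)/(0.499−1/8)))/0.499`. Proof: the tree's proof of (B) (Nathanson
Thm 10.5) with Iwaniec's upper bound for each `𝒜_q` (level `x^{0.499}/q`) in twisted form
(`Iwaniec1980_twisted_upper_of_half_lt`, `b = ½1_{𝒜_q}(1 − μ)`, `e = 1_{𝒜_q}μ`): main term
`½ π(x; q, −2) V (e^γ(1/4)/(0.499 − log q/log x) + C(log x^{1/8})^{−1/3})`, Bombieri–Vinogradov at level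
`0.499` for all `δ`-terms, the prime sum by `sum_primesIco_weight_le_level0499`, and the oracle remainders
rearranged into `½ E₁(x)` (`sum_primesIco_sum_le_sum_Icc`, `sum_moebius_twinSieveSet_filter_dvd_eq`). -/
theorem parityMoebius_twin_sieveUpperSum :
    ∀ ε : ℝ, 0 < ε → ∀ᶠ x : ℕ in atTop,
      (∑ q ∈ primesIco (twinZ x) (twinY x),
        ∑ n ∈ (twinSieveSet x).filter (fun n => q ∣ n ∧ IsRough (twinZ x) n), (1 - (μ n : ℝ)) / 2) ≤
        (Real.exp Real.eulerMascheroniConstant *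
              ((Real.log ((1 / 3) / (0.499 - 1 / 3)) - Real.log ((1 / 8) / (0.499 - 1 / 8))) / 0.499) / 8 +
            ε) * twinMainTerm x +
          (∑ m ∈ Finset.Icc 1 ⌊(x : ℝ) ^ (0.499 : ℝ)⌋₊,
            |∑ p ∈ (Nat.primesLE x).filter (fun p => m ∣ p + 2),
              (ArithmeticFunction.moebius (p + 2) : ℝ)|) / 2 := by
  intro ε hε
  set G := Real.exp Real.eulerMascheroniConstant with hG
  have hG0 : 0 < G := Real.exp_pos _
  set Λ := (Real.log ((1 / 3) / (0.499 - 1 / 3)) - Real.log ((1 / 8) / (0.499 - 1 / 8))) / 0.499 with hΛ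
  have hΛ0 : 0 < Λ := by
    have h1 : 0 < Real.log ((1 / 3 : ℝ) / (0.499 - 1 / 3)) := Real.log_pos (by norm_num)
    have h2 : Real.log ((1 / 8 : ℝ) / (0.499 - 1 / 8)) < 0 := Real.log_neg (by norm_num) (by norm_num)
    rw [hΛ]
    exact div_pos (by linarith) (by norm_num)
  set a := G * Λ / 4 with ha
  have ha0 : 0 < a := by positivity
  have haq : G * Λ / 8 = a / 2 := by rw [ha]; ring
  rw [haq]
  -- the level `0.499` and its two numerical properties
  have hθhalf : (0.499 : ℝ) < 1 / 2 := by norm_num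
  have hθlow : (23 : ℝ) / 48 < 0.499 := by norm_num
  -- names for the error sum
  set EE : ℕ → ℝ := fun x => ∑ m ∈ Finset.Icc 1 ⌊(x : ℝ) ^ (0.499 : ℝ)⌋₊,
    |∑ p ∈ (Nat.primesLE x).filter (fun p => m ∣ p + 2), (ArithmeticFunction.moebius (p + 2) : ℝ)|
    with hEEdef
  -- parameters and the deep inputs
  obtain ⟨h, hh0, hh1, hMAL⟩ := sum_primesIco_weight_le_level0499 (show 0 < ε / (8 * G) by positivity)
  obtain ⟨C, hC⟩ := eventually_sum_abs_primeCountingDisc_le BombieriVinogradovStatement_holds hθhalf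
    (A := 5) (by norm_num)
  obtain ⟨B, hB, hCfun⟩ := Iwaniec1980_twisted_upper_of_half_lt (κ := (1 : ℝ)) (by norm_num)
  obtain ⟨C₁, hC₁⟩ := hCfun (54 * Real.exp (54 / Real.log 2))
  set η₂ := ε / (4 * a + ε) with hη₂
  have hη₂0 : 0 < η₂ := by positivity
  set c₀ := 16 * Real.exp (-7) with hc₀
  have hc₀0 : 0 < c₀ := by positivity
  set C' := (2 * G + 2 + Real.exp 5) * max C 0 with hC'
  -- eventualities
  have hE4 : ∀ᶠ x : ℕ in atTop, max C₁ 0 * (Real.log x / 8) ^ (-(1 / 3 : ℝ)) ≤ min (ε / 24) 1 := by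
    have h1 : Tendsto (fun x : ℕ => Real.log x / 8) atTop atTop :=
      (Real.tendsto_log_atTop.comp tendsto_natCast_atTop_atTop).atTop_div_const (by norm_num)
    have h2 : Tendsto (fun x : ℕ => (Real.log x / 8) ^ (-(1 / 3 : ℝ))) atTop (𝓝 0) :=
      (tendsto_rpow_neg_atTop (by norm_num : (0 : ℝ) < 1 / 3)).comp h1
    have h3 := h2.const_mul (max C₁ 0)
    exact (mul_zero (max C₁ 0) ▸ h3).eventually_le_const (by positivity)
  have hE5 : ∀ᶠ x : ℕ in atTop, C' ≤ ε / 2 * c₀ * Real.log x ^ 2 := by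
    have h1 : Tendsto (fun x : ℕ => ε / 2 * c₀ * Real.log x ^ 2) atTop atTop := by
      refine Tendsto.const_mul_atTop (by positivity) ?_
      exact (tendsto_pow_atTop two_ne_zero).comp (Real.tendsto_log_atTop.comp tendsto_natCast_atTop_atTop)
    exact h1.eventually_ge_atTop C'
  filter_upwards [hMAL, hC, eventually_primeCounting_bounds hη₂0, eventually_twinY_le_rpow_third_add hh0,
    eventually_sum_primesIco_inv_sub_one_le, hE4, hE5, eventually_ge_atTop 6561]
    with x hMALx hBVx hPNT hxy hS2 hEx hC'x hx
  -- basic facts about `x`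
  have hx1 : (1 : ℝ) < x := by exact_mod_cast (show 1 < x by omega)
  have hx0 : (0 : ℝ) < x := by linarith
  have hLx : 0 < Real.log x := Real.log_pos hx1
  have hLx1 : 1 ≤ Real.log x := by
    have hx3 : (3 : ℝ) ≤ x := by exact_mod_cast (show 3 ≤ x by omega)
    rw [Real.le_log_iff_exp_le (by linarith)]
    exact (Real.exp_one_lt_d9.le.trans (by norm_num)).trans hx3
  have hx256 : (256 : ℝ) ≤ x := by exact_mod_cast (show 256 ≤ x by omega)
  have hx6561 : (6561 : ℝ) ≤ x := by exact_mod_cast hx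
  -- names
  set X := (x : ℝ) with hX
  set ℓ := Real.log X with hℓ
  set zr := X ^ (1 / 8 : ℝ) with hzr
  set D := X ^ (0.499 : ℝ) with hD
  set V := sieveProduct 2 zr with hV
  set L := X / ℓ with hL
  set πx := (Nat.primeCounting x : ℝ) with hπx
  set Q := primesIco (twinZ x) (twinY x) with hQ
  set P := primesProdBelow zr with hP
  set E := max C₁ 0 * (ℓ / 8) ^ (-(1 / 3 : ℝ)) with hEdef
  set Sg := ∑ d ∈ P.divisors, shiftedPrimesDensity 2 d with hSg
  set SD := ∑ m ∈ Finset.Icc 1 ⌊D⌋₊, |primeCountingDisc m (negTwoUnit m : ZMod m) x| with hSD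
  set SM := ∑ m ∈ Finset.Icc 1 ⌊D⌋₊,
    |∑ n ∈ (twinSieveSet x).filter (fun n => m ∣ n), (μ n : ℝ)| with hSM
  -- facts about the parameters at `x`
  have hzr2 : 2 ≤ zr := by
    rw [hzr, show (2 : ℝ) = ((2 : ℝ) ^ (8 : ℕ)) ^ (1 / 8 : ℝ) by
      rw [← Real.rpow_natCast, ← Real.rpow_mul (by norm_num)]; norm_num]
    exact Real.rpow_le_rpow (by norm_num) (by norm_num; exact hx256) (by norm_num)
  have hzr3 : 3 ≤ zr := by
    rw [hzr, show (3 : ℝ) = ((3 : ℝ) ^ (8 : ℕ)) ^ (1 / 8 : ℝ) by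
      rw [← Real.rpow_natCast, ← Real.rpow_mul (by norm_num)]; norm_num]
    exact Real.rpow_le_rpow (by norm_num) (by norm_num; exact hx6561) (by norm_num)
  have hzr0 : 0 < zr := by linarith
  have hlogzr : Real.log zr = ℓ / 8 := by rw [hzr, Real.log_rpow hx0]; ring
  have hlogD : Real.log D = 0.499 * ℓ := by rw [hD, Real.log_rpow hx0]
  have hD0 : 0 < D := Real.rpow_pos_of_pos hx0 _
  have hVI : 0 ≤ V ∧ V ≤ 1 := sieveProduct_two_mem_Icc zr
  have hmainTerm : twinMainTerm x = L * V := by rw [twinMainTerm]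
  have hLV : c₀ * X / ℓ ^ 2 ≤ L * V := by rw [← hmainTerm, hc₀]; exact twinMainTerm_ge hx
  have hL0 : 0 ≤ L := by positivity
  have hπle : πx ≤ (1 + η₂) * L := hPNT.2
  have hπ0 : 0 ≤ πx := Nat.cast_nonneg _
  have hE0 : 0 ≤ E := mul_nonneg (le_max_right _ _) (Real.rpow_nonneg (by positivity) _)
  have hEε : E ≤ ε / 24 := hEx.trans (min_le_left _ _)
  have hE1 : E ≤ 1 := hEx.trans (min_le_right _ _)
  have hSg0 : 0 ≤ Sg := Finset.sum_nonneg fun d _ => by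
    rw [shiftedPrimesDensity_apply]; split_ifs <;> positivity
  have hSgle : Sg ≤ Real.exp 5 * ℓ := by
    refine (sum_divisors_shiftedPrimesDensity_le hzr3).trans ?_
    rw [hlogzr]
    have : 0 ≤ Real.exp 5 * ℓ := mul_nonneg (Real.exp_pos 5).le hLx.le
    linarith only [this]
  have hSD0 : 0 ≤ SD := Finset.sum_nonneg fun m _ => abs_nonneg _
  have hSDle : SD ≤ max C 0 * X / ℓ ^ 5 := by
    have h1 := hBVx negTwoUnit
    rw [show (5 : ℝ) = ((5 : ℕ) : ℝ) by norm_num, Real.rpow_natCast] at h1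
    refine h1.trans ?_
    have : 0 ≤ X / ℓ ^ 5 := by positivity
    rw [mul_div_assoc, mul_div_assoc]
    exact mul_le_mul_of_nonneg_right (le_max_left _ _) this
  have hSM0 : 0 ≤ SM := Finset.sum_nonneg fun m _ => abs_nonneg _
  have hSMEE : SM = EE x := by
    rw [hSM, hEEdef]
    exact Finset.sum_congr rfl fun m _ => by rw [sum_moebius_twinSieveSet_filter_dvd_eq]
  have hyD : (twinY x : ℝ) ≤ D :=
    hxy.trans (Real.rpow_le_rpow_of_exponent_le hx1.le (by linarith))
  have hyzr : (twinY x : ℝ) * zr ≤ D := by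
    calc (twinY x : ℝ) * zr ≤ X ^ (1 / 3 + h) * zr := mul_le_mul_of_nonneg_right hxy hzr0.le
      _ = X ^ (1 / 3 + h + 1 / 8) := by rw [hzr, ← Real.rpow_add hx0]
      _ ≤ D := Real.rpow_le_rpow_of_exponent_le hx1.le (by linarith)
  -- per-q facts
  have hQfacts : ∀ q ∈ Q, q.Prime ∧ 3 ≤ q ∧ twinZ x ≤ q ∧ zr ≤ q ∧ (q : ℝ) < twinY x := by
    intro q hq
    rw [hQ, primesIco, Finset.mem_filter, Finset.mem_Ico] at hq
    have hzrq : zr ≤ q := twinZ_le_iff.mp hq.1.1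
    have hq3 : 3 ≤ q := by exact_mod_cast (show (3 : ℝ) ≤ q from hzr3.trans hzrq)
    exact ⟨hq.2, hq3, hq.1.1, hzrq, by exact_mod_cast hq.1.2⟩
  -- the bound for one prime `q`: half the tree's bound plus half the oracle remainder
  have hperq : ∀ q ∈ Q,
      (∑ n ∈ (twinSieveSet x).filter (fun n => q ∣ n ∧ IsRough (twinZ x) n), (1 - (μ n : ℝ)) / 2) ≤
      (1 / 2) * (V * (πx * (G * (1 / ((q : ℝ) - 1) * ((1 / 4) / (0.499 - Real.log q / Real.log x))) +
          E * (1 / ((q : ℝ) - 1))) +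
        (2 * G + E) * |primeCountingDisc q (negTwoUnit q : ZMod q) x|) +
      ((∑ d ∈ (Finset.range ⌈D / q⌉₊).filter (· ∣ P),
          |primeCountingDisc (q * d) (negTwoUnit (q * d) : ZMod (q * d)) x|) +
        Sg * |primeCountingDisc q (negTwoUnit q : ZMod q) x|)) +
      (1 / 2) * (∑ d ∈ (Finset.range ⌈D / q⌉₊).filter (· ∣ P),
        |∑ n ∈ (twinSieveSet x).filter (fun n => q * d ∣ n), (μ n : ℝ)|) := by
    intro q hq
    obtain ⟨hqp, hq3, hzq, hzrq, hqy⟩ := hQfacts q hq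
    have hqodd : Odd q := hqp.odd_of_ne_two (by omega)
    have hq0 : (0 : ℝ) < q := by exact_mod_cast hqp.pos
    have hq3r : (3 : ℝ) ≤ q := by exact_mod_cast hq3
    have hq1 : (0 : ℝ) < (q : ℝ) - 1 := by linarith
    have hzq' : ⌈zr⌉₊ ≤ q := hzq
    set δq := primeCountingDisc q (negTwoUnit q : ZMod q) x with hδq
    -- Iwaniec's theorem (twisted) for `𝒜_q` with level `D/q`
    have hzy : zr ≤ D / q := by
      rw [le_div_iff₀ hq0]
      calc zr * q ≤ zr * twinY x := mul_le_mul_of_nonneg_left hqy.le hzr0.le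
        _ = twinY x * zr := mul_comm _ _
        _ ≤ D := hyzr
    have hsize : 0 ≤ (twinSeqMult x q).size ((x + 2 : ℕ) : ℝ) := Nat.cast_nonneg _
    have hb : ∀ n, 0 ≤ (twinWeightMult x q n - twinWeightMult x q n * (μ n : ℝ)) / 2 :=
      twinWeightMult_twisted_nonneg x q
    have hbe : ∀ n, 2 * ((twinWeightMult x q n - twinWeightMult x q n * (μ n : ℝ)) / 2) +
        twinWeightMult x q n * (μ n : ℝ) ≤ (twinSeqMult x q).a n := fun n => by
      change _ ≤ twinWeightMult x q n
      linarith
    have hI := hC₁ (twinSeqMult x q) hasIwaniecDimension_shiftedPrimesDensity_two _ _ hb hbe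
      ((x + 2 : ℕ) : ℝ) (D / q) zr hzr2 hzy hsize
    rw [twistedSifted_twinSeqMult_moebius_eq, densityProduct_twinSeqMult_eq] at hI
    change (∑ n ∈ (twinSieveSet x).filter (fun n => q ∣ n ∧ IsRough (twinZ x) n),
      (1 - (μ n : ℝ)) / 2) ≤ _ at hI
    -- the oracle remainder of `𝒜_q`
    have hREq : ∑ d ∈ (Finset.range ⌈D / q⌉₊).filter (· ∣ primesProdBelow zr),
        |∑ n ∈ (Finset.Ioc 0 ⌊((x + 2 : ℕ) : ℝ)⌋₊).filter (d ∣ ·),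
          twinWeightMult x q n * (μ n : ℝ)| =
        ∑ d ∈ (Finset.range ⌈D / q⌉₊).filter (· ∣ P),
          |∑ n ∈ (twinSieveSet x).filter (fun n => q * d ∣ n), (μ n : ℝ)| := by
      refine Finset.sum_congr rfl fun d hd => ?_
      rw [twistedCongrSum_twinSeqMult_moebius_eq (coprime_of_ceil_le_of_dvd_primesProdBelow hqp hzq'
        (Finset.mem_filter.mp hd).2)]
    rw [hREq] at hI
    -- the size `|𝒜_q| = π(x; q, -2) = δ(x; q) + π(x)/(q - 1)`
    have hsz : (twinSeqMult x q).size ((x + 2 : ℕ) : ℝ) = δq + πx / ((q : ℝ) - 1) := by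
      change (#((twinSieveSet x).filter (fun n => q ∣ n)) : ℝ) = _
      rw [card_filter_dvd_twinSieveSet hqodd hq3, primeCountingMod_negTwo_eq hqodd hq3,
        Nat.totient_prime hqp, Nat.cast_sub hqp.one_lt.le, Nat.cast_one]
    -- `s_q = log(D/q)/log zr = 8 (0.499 - t_q)` and `F(s_q) = 2e^γ/s_q`
    set tq := Real.log q / ℓ with htq
    have htq1 : 1 / 8 ≤ tq := by
      rw [htq, le_div_iff₀ hLx]
      have := Real.log_le_log hzr0 hzrq
      rw [hlogzr] at this
      linarith
    have htq2 : tq < 1 / 3 + h := by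
      rw [htq, div_lt_iff₀ hLx]
      have h2 := Real.log_lt_log hq0 (hqy.trans_le hxy)
      rwa [Real.log_rpow hx0] at h2
    have hsq : Real.log (D / q) / Real.log zr = 8 * (0.499 - tq) := by
      rw [Real.log_div hD0.ne' hq0.ne', hlogD, hlogzr, htq, div_eq_iff (by positivity)]
      field_simp
    have hgap : 1 / 8 < 0.499 - tq := by linarith
    have hsqpos : 0 < 8 * (0.499 - tq) := by linarith
    have hsq3 : 8 * (0.499 - tq) ≤ 3 := by linarith
    set wq := (1 / 4) / (0.499 - tq) with hwq
    have hw0 : 0 ≤ wq := div_nonneg (by norm_num) (by linarith)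
    have hw2 : wq ≤ 2 := by
      rw [hwq, div_le_iff₀ (by linarith)]; linarith
    have hF : B.1 (Real.log (D / q) / Real.log zr) = G * wq := by
      rw [hsq, hB.eqOn_iwaniecSieveFun.1 (Set.mem_Ioi.mpr hsqpos),
        iwaniecUpperSieveFun_one_eq_div ⟨hsqpos, hsq3⟩, rosserAdjointP_one_one, Real.exp_neg, ← hG,
        hwq]
      field_simp
      ring
    -- the error term `C₁ (log (D/q))^{-1/3} ≤ E`
    have herr : C₁ * Real.log (D / q) ^ (-(1 / 3 : ℝ)) ≤ E := by
      have hlogDq : Real.log zr ≤ Real.log (D / q) := Real.log_le_log hzr0 hzy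
      have hpos : 0 < Real.log zr := by rw [hlogzr]; positivity
      have h1 : Real.log (D / q) ^ (-(1 / 3 : ℝ)) ≤ Real.log zr ^ (-(1 / 3 : ℝ)) :=
        Real.rpow_le_rpow_of_nonpos hpos hlogDq (by norm_num)
      have h2 : 0 ≤ Real.log (D / q) ^ (-(1 / 3 : ℝ)) := Real.rpow_nonneg (hpos.le.trans hlogDq) _
      rw [hEdef, ← hlogzr]
      calc C₁ * Real.log (D / q) ^ (-(1 / 3 : ℝ)) ≤ max C₁ 0 * Real.log (D / q) ^ (-(1 / 3 : ℝ)) :=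
            mul_le_mul_of_nonneg_right (le_max_left _ _) h2
        _ ≤ max C₁ 0 * Real.log zr ^ (-(1 / 3 : ℝ)) := mul_le_mul_of_nonneg_left h1 (le_max_right _ _)
    have hcoef : B.1 (Real.log (D / q) / Real.log zr) + C₁ * Real.log (D / q) ^ (-(1 / 3 : ℝ)) ≤
        G * wq + E := by rw [hF]; linarith
    have hcoef0 : 0 ≤ G * wq + E := by positivity
    -- size bound and the main term
    have hszle : (twinSeqMult x q).size ((x + 2 : ℕ) : ℝ) ≤ πx / ((q : ℝ) - 1) + |δq| := by
      rw [hsz]; linarith [le_abs_self δq]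
    have hmain : (twinSeqMult x q).size ((x + 2 : ℕ) : ℝ) * V *
        (B.1 (Real.log (D / q) / Real.log zr) + C₁ * Real.log (D / q) ^ (-(1 / 3 : ℝ))) ≤
          (πx / ((q : ℝ) - 1) + |δq|) * V * (G * wq + E) := by
      have h1 : (twinSeqMult x q).size ((x + 2 : ℕ) : ℝ) * V *
          (B.1 (Real.log (D / q) / Real.log zr) + C₁ * Real.log (D / q) ^ (-(1 / 3 : ℝ))) ≤
            (twinSeqMult x q).size ((x + 2 : ℕ) : ℝ) * V * (G * wq + E) :=
        mul_le_mul_of_nonneg_left hcoef (mul_nonneg hsize hVI.1)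
      have h2 : (twinSeqMult x q).size ((x + 2 : ℕ) : ℝ) * V * (G * wq + E) ≤
          (πx / ((q : ℝ) - 1) + |δq|) * V * (G * wq + E) :=
        mul_le_mul_of_nonneg_right (mul_le_mul_of_nonneg_right hszle hVI.1) hcoef0
      linarith
    -- the remainder term
    have hR := remainderSum_twinSeqMult_le (x := x) (z := zr) (Y := D / q) hqp hq3 hzq
    -- combine
    have hGw : G * wq ≤ G * 2 := mul_le_mul_of_nonneg_left hw2 hG0.le
    have h3 : V * |δq| * (G * wq + E) ≤ V * |δq| * (2 * G + E) :=
      mul_le_mul_of_nonneg_left (by linarith only [hGw]) (mul_nonneg hVI.1 (abs_nonneg _))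
    have hid : (πx / ((q : ℝ) - 1) + |δq|) * V * (G * wq + E) =
        V * (πx * (G * (1 / ((q : ℝ) - 1) * wq) + E * (1 / ((q : ℝ) - 1)))) + V * |δq| * (G * wq + E) := by
      ring
    have hid2 : V * (πx * (G * (1 / ((q : ℝ) - 1) * wq) + E * (1 / ((q : ℝ) - 1))) + (2 * G + E) * |δq|) =
        V * (πx * (G * (1 / ((q : ℝ) - 1) * wq) + E * (1 / ((q : ℝ) - 1)))) + V * |δq| * (2 * G + E) := by
      ring
    rw [hid2]
    have hold : (twinSeqMult x q).size ((x + 2 : ℕ) : ℝ) * V *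
            (B.1 (Real.log (D / q) / Real.log zr) + C₁ * Real.log (D / q) ^ (-(1 / 3 : ℝ))) +
          ∑ d ∈ (Finset.range ⌈D / q⌉₊).filter (· ∣ P), |(twinSeqMult x q).remainder d ((x + 2 : ℕ) : ℝ)| ≤
        V * (πx * (G * (1 / ((q : ℝ) - 1) * wq) + E * (1 / ((q : ℝ) - 1)))) + V * |δq| * (2 * G + E) +
          ((∑ d ∈ (Finset.range ⌈D / q⌉₊).filter (· ∣ P),
              |primeCountingDisc (q * d) (negTwoUnit (q * d) : ZMod (q * d)) x|) + Sg * |δq|) := by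
      calc _ ≤ (πx / ((q : ℝ) - 1) + |δq|) * V * (G * wq + E) +
            ((∑ d ∈ (Finset.range ⌈D / q⌉₊).filter (· ∣ P),
                |primeCountingDisc (q * d) (negTwoUnit (q * d) : ZMod (q * d)) x|) + |δq| * Sg) :=
            add_le_add hmain hR
        _ ≤ _ := by rw [hid, mul_comm (|δq|) Sg]; linarith [h3]
    have hhalf := mul_le_mul_of_nonneg_left hold (by norm_num : (0 : ℝ) ≤ 1 / 2)
    linarith [hI, hhalf]
  -- sum over `q`
  have hsum := Finset.sum_le_sum hperq
  have hsplit : ∑ q ∈ Q, ((1 / 2) * (V * (πx * (G * (1 / ((q : ℝ) - 1) *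
          ((1 / 4) / (0.499 - Real.log q / Real.log x))) + E * (1 / ((q : ℝ) - 1))) +
        (2 * G + E) * |primeCountingDisc q (negTwoUnit q : ZMod q) x|) +
      ((∑ d ∈ (Finset.range ⌈D / q⌉₊).filter (· ∣ P),
          |primeCountingDisc (q * d) (negTwoUnit (q * d) : ZMod (q * d)) x|) +
        Sg * |primeCountingDisc q (negTwoUnit q : ZMod q) x|)) +
      (1 / 2) * (∑ d ∈ (Finset.range ⌈D / q⌉₊).filter (· ∣ P),
        |∑ n ∈ (twinSieveSet x).filter (fun n => q * d ∣ n), (μ n : ℝ)|)) =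
      (1 / 2) * (V * πx * G * (∑ q ∈ Q, 1 / ((q : ℝ) - 1) * ((1 / 4) / (0.499 - Real.log q / Real.log x))) +
        V * πx * E * (∑ q ∈ Q, 1 / ((q : ℝ) - 1)) +
        (V * (2 * G + E) + Sg) * (∑ q ∈ Q, |primeCountingDisc q (negTwoUnit q : ZMod q) x|) +
        ∑ q ∈ Q, ∑ d ∈ (Finset.range ⌈D / q⌉₊).filter (· ∣ P),
          |primeCountingDisc (q * d) (negTwoUnit (q * d) : ZMod (q * d)) x|) +
      (1 / 2) * (∑ q ∈ Q, ∑ d ∈ (Finset.range ⌈D / q⌉₊).filter (· ∣ P),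
        |∑ n ∈ (twinSieveSet x).filter (fun n => q * d ∣ n), (μ n : ℝ)|) := by
    simp only [Finset.sum_add_distrib, ← Finset.mul_sum]
    ring
  rw [hsplit] at hsum
  -- the five sums
  have hS1 : ∑ q ∈ Q, 1 / ((q : ℝ) - 1) * ((1 / 4) / (0.499 - Real.log q / Real.log x)) ≤
      (1 / 4) * Λ + ε / (8 * G) := hMALx
  have hS3 : ∑ q ∈ Q, |primeCountingDisc q (negTwoUnit q : ZMod q) x| ≤ SD := by
    refine Finset.sum_le_sum_of_subset_of_nonneg (fun q hq => ?_) fun m _ _ => abs_nonneg _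
    obtain ⟨hqp, -, -, -, hqy⟩ := hQfacts q hq
    rw [Finset.mem_Icc]
    refine ⟨hqp.one_lt.le, Nat.le_floor ?_⟩
    exact (hqy.le.trans hyD)
  have hS4 : ∑ q ∈ Q, ∑ d ∈ (Finset.range ⌈D / q⌉₊).filter (· ∣ P),
      |primeCountingDisc (q * d) (negTwoUnit (q * d) : ZMod (q * d)) x| ≤ SD :=
    sum_sum_abs_primeCountingDisc_le x (twinY x) zr D
  have hS5 : ∑ q ∈ Q, ∑ d ∈ (Finset.range ⌈D / q⌉₊).filter (· ∣ P),
      |∑ n ∈ (twinSieveSet x).filter (fun n => q * d ∣ n), (μ n : ℝ)| ≤ SM :=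
    sum_primesIco_sum_le_sum_Icc (F := fun m =>
      |∑ n ∈ (twinSieveSet x).filter (fun n => m ∣ n), (μ n : ℝ)|)
      (fun m => abs_nonneg _) (twinY x) zr D
  -- the main term
  have hVπ0 : 0 ≤ V * πx := mul_nonneg hVI.1 hπ0
  have hM1 : V * πx * G * (∑ q ∈ Q, 1 / ((q : ℝ) - 1) * ((1 / 4) / (0.499 - Real.log q / Real.log x))) ≤
      V * πx * G * ((1 / 4) * Λ + ε / (8 * G)) :=
    mul_le_mul_of_nonneg_left hS1 (by positivity)
  have hM2 : V * πx * E * (∑ q ∈ Q, 1 / ((q : ℝ) - 1)) ≤ V * πx * E * 3 :=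
    mul_le_mul_of_nonneg_left hS2 (by positivity)
  have hM3 : V * πx * G * ((1 / 4) * Λ + ε / (8 * G)) + V * πx * E * 3 ≤ V * πx * (a + ε / 4) := by
    have e1 : V * πx * G * ((1 / 4) * Λ + ε / (8 * G)) = V * πx * (a + ε / 8) := by
      rw [ha]; field_simp
    rw [e1]
    have h4 : V * πx * E ≤ V * πx * (ε / 24) := mul_le_mul_of_nonneg_left hEε hVπ0
    linarith only [h4]
  have hM4 : V * πx * (a + ε / 4) ≤ V * ((1 + η₂) * L) * (a + ε / 4) := by
    have : V * πx ≤ V * ((1 + η₂) * L) := mul_le_mul_of_nonneg_left hπle hVI.1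
    exact mul_le_mul_of_nonneg_right this (by positivity)
  have hM5 : V * ((1 + η₂) * L) * (a + ε / 4) = (a + ε / 2) * (L * V) := by
    have e2 : (1 + η₂) * (a + ε / 4) = a + ε / 2 := by
      rw [hη₂]; field_simp; ring
    calc V * ((1 + η₂) * L) * (a + ε / 4) = ((1 + η₂) * (a + ε / 4)) * (L * V) := by ring
      _ = (a + ε / 2) * (L * V) := by rw [e2]
  -- the junk
  have hJ1 : (V * (2 * G + E) + Sg) * (∑ q ∈ Q, |primeCountingDisc q (negTwoUnit q : ZMod q) x|) +
      ∑ q ∈ Q, ∑ d ∈ (Finset.range ⌈D / q⌉₊).filter (· ∣ P),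
        |primeCountingDisc (q * d) (negTwoUnit (q * d) : ZMod (q * d)) x| ≤
      (2 * G + 2 + Real.exp 5 * ℓ) * SD := by
    have h1 : V * (2 * G + E) + Sg ≤ 2 * G + 1 + Real.exp 5 * ℓ := by
      have : V * (2 * G + E) ≤ 1 * (2 * G + 1) := by
        refine mul_le_mul hVI.2 (by linarith) (by positivity) zero_le_one
      linarith
    have h2 := mul_le_mul h1 hS3 (Finset.sum_nonneg fun q _ => abs_nonneg _)
      (add_nonneg (by positivity) (mul_nonneg (Real.exp_pos 5).le hLx.le))
    linarith only [h2, hS4]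
  have hJ2 : (2 * G + 2 + Real.exp 5 * ℓ) * SD ≤ ε / 2 * (L * V) := by
    have h1 : 2 * G + 2 + Real.exp 5 * ℓ ≤ (2 * G + 2 + Real.exp 5) * ℓ := by
      have : 0 ≤ (2 * G + 2) * (ℓ - 1) := mul_nonneg (by positivity) (by linarith only [hLx1])
      linarith only [this]
    calc (2 * G + 2 + Real.exp 5 * ℓ) * SD ≤ ((2 * G + 2 + Real.exp 5) * ℓ) * (max C 0 * X / ℓ ^ 5) :=
          mul_le_mul h1 hSDle hSD0 (mul_nonneg (by positivity) hLx.le)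
      _ = C' * X / ℓ ^ 4 := by rw [hC']; field_simp
      _ ≤ (ε / 2 * c₀ * ℓ ^ 2) * X / ℓ ^ 4 := by gcongr
      _ = ε / 2 * (c₀ * X / ℓ ^ 2) := by field_simp
      _ ≤ ε / 2 * (L * V) := mul_le_mul_of_nonneg_left hLV (by positivity)
  -- conclusion
  have hLV0 : 0 ≤ L * V := mul_nonneg hL0 hVI.1
  change _ ≤ (a / 2 + ε) * twinMainTerm x + EE x / 2
  rw [hmainTerm, ← hSMEE]
  linarith only [hsum, hM1, hM2, hM3, hM4, hM5, hJ1, hJ2, hS5, mul_nonneg hε.le hLV0]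

end Summit.Parity.GeneralizedHardyLittlewood.Theorems
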